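import Summits.AtomisticToContinuum.Crystallization.Theorems.FrustratedLawDichotomyCellArithNashInt
import Mathlib.Analysis.Calculus.MeanValue
import Mathlib.Analysis.Calculus.Deriv.Inv
import Mathlib.Analysis.Calculus.Deriv.Pow

/-!
# FrustratedLawDichotomy · crux `AperiodicFrustratedLawGap` (stmt-AtomisticToContinuum-27623) — CELL-ARITH, «NASH-LIP» real half:
# the pair force pieces are LIPSCHITZ in the cell metric (decomp-a2c hand-1 g53; critic r1792 (C)(c) / r1796 (B): the Tier-K capacity
# lever «read the NASH block ONCE at the box centre G = 1 + an ε·Lip slack», census NASH-LIP ΣLip = 422 (F1) / 342 (fcc) priced)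

The real-analysis lemma the centre-plus-slack K-format needs, (238)-style and representation-free:
* §1 `psiT2` (`ψ″ = 20t⁻⁶ − 56t⁻⁹`), the derivatives `hasDerivAt_psiT` (`ψ′ = psiT1`), `hasDerivAt_psiT1` (`= psiT2`), the window
  enclosure `psiT2_mem` / `abs_psiT2_le`;
* §2 ★ `abs_psiT_sub_le` / `abs_psiT1_sub_le` — on a window `[lo, hi]`, `0 < lo`: `|ψ t − ψ s| ≤ Ψ₁(lo,hi)·|t − s|`,
  `|ψ′ t − ψ′ s| ≤ Ψ₂(lo,hi)·|t − s|` with `Ψ₁ = (238)'s |ψ′| window bound`, `Ψ₂ = abs_psiT2_le's bound` (mean value theorem,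
  `Convex.norm_image_sub_le_of_norm_hasDerivWithin_le` — the TRUE derivative sup, not the termwise constant, because `ψ′` nearly vanishes
  on the nearest-neighbour shell);
* §3 `gram_one` (`g_1(v, w) = Σ vᵢwᵢ`) and ★ `abs_linLab_sub_linLab_one_le` — for `|G − 1| ≤ ε` entrywise and both `g_G(z,z)` and `|z|²`
  in the class window: `|(linLab G z y) i − (linLab 1 z y) i| ≤ ε·(Ψ₁·|z|₁²·|y i| + 2|z i|·(|z|₁|y|₁·Ψ₁ + |z·y|·Ψ₂·|z|₁²))`
  (`|z|₁ = Σ|z j|`, via `…CellArithNashInt.abs_gram_sub_dot_le`).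
The integer packaging (centre value by exact label arithmetic + this slack read per class) is the K-format's next step.
DEFS `psiT2` (plain); imports `…CellArithNashInt` + Mathlib calculus (MeanValue, Deriv.Inv, Deriv.Pow); 0 sorry.  Tags: [folklore].
-/

noncomputable section

namespace Summit.AtomisticToContinuum.Crystallization.Theorems.FrustratedLawDichotomyCellArithLip

open scoped BigOperators
open Summit.AtomisticToContinuum.Crystallization.Theorems.FrustratedLawDichotomyFarFieldSharp (inv_pow_le_inv_pow_of_le)
open Summit.AtomisticToContinuum.Crystallization.Theorems.FrustratedLawDichotomyCoherentFloorAlgebra (psiT psiT1)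
open Summit.AtomisticToContinuum.Crystallization.Theorems.FrustratedLawDichotomyCellEnclosures (psiT1_mem abs_psiT1_le abs_le_max_neg)
open Summit.AtomisticToContinuum.Crystallization.Theorems.FrustratedLawDichotomyCellMetric (gram linLab)
open Summit.AtomisticToContinuum.Crystallization.Theorems.FrustratedLawDichotomyCellArithNashInt (abs_gram_sub_dot_le)

/-! ## §1 `ψ″` and the derivatives -/

/-- `ψ″(t) = 20t⁻⁶ − 56t⁻⁹` (the derivative of (225) `psiT1`). [folklore] -/
def psiT2 (t : ℝ) : ℝ := 20 * t⁻¹ ^ 6 - 56 * t⁻¹ ^ 9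

/-- `ψ′ = psiT1` as a derivative (`t ≠ 0`). [folklore] -/
theorem hasDerivAt_psiT {t : ℝ} (ht : t ≠ 0) : HasDerivAt psiT (psiT1 t) t := by
  have h := ((hasDerivAt_inv ht).fun_pow 4).sub ((hasDerivAt_inv ht).fun_pow 7)
  have e : ((fun y : ℝ => y⁻¹ ^ 4) - fun y : ℝ => y⁻¹ ^ 7) = psiT := by funext y; simp [psiT]
  rw [e] at h
  refine h.congr_deriv ?_
  rw [show psiT1 t = -4 * t⁻¹ ^ 5 + 7 * t⁻¹ ^ 8 from rfl]
  push_cast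
  field_simp
  ring

/-- `ψ″ = psiT2` as the derivative of `psiT1` (`t ≠ 0`). [folklore] -/
theorem hasDerivAt_psiT1 {t : ℝ} (ht : t ≠ 0) : HasDerivAt psiT1 (psiT2 t) t := by
  have h := (((hasDerivAt_inv ht).fun_pow 5).const_mul (-4)).add (((hasDerivAt_inv ht).fun_pow 8).const_mul 7)
  have e : ((fun y : ℝ => -4 * y⁻¹ ^ 5) + fun y : ℝ => 7 * y⁻¹ ^ 8) = psiT1 := by funext y; simp [psiT1]
  rw [e] at h
  refine h.congr_deriv ?_
  rw [show psiT2 t = 20 * t⁻¹ ^ 6 - 56 * t⁻¹ ^ 9 from rfl]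
  push_cast
  field_simp
  ring

/-- `ψ″` on a window: `ψ″(t) ∈ [20hi⁻⁶ − 56lo⁻⁹, 20lo⁻⁶ − 56hi⁻⁹]`. [folklore] -/
theorem psiT2_mem {lo hi t : ℝ} (h0 : 0 < lo) (h1 : lo ≤ t) (h2 : t ≤ hi) :
    20 * hi⁻¹ ^ 6 - 56 * lo⁻¹ ^ 9 ≤ psiT2 t ∧ psiT2 t ≤ 20 * lo⁻¹ ^ 6 - 56 * hi⁻¹ ^ 9 := by
  unfold psiT2
  have := inv_pow_le_inv_pow_of_le h0 h1 6; have := inv_pow_le_inv_pow_of_le h0 h1 9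
  have := inv_pow_le_inv_pow_of_le (h0.trans_le h1) h2 6; have := inv_pow_le_inv_pow_of_le (h0.trans_le h1) h2 9
  constructor <;> linarith

/-- `|ψ″|` on a window. [folklore] -/
theorem abs_psiT2_le {lo hi t : ℝ} (h0 : 0 < lo) (h1 : lo ≤ t) (h2 : t ≤ hi) :
    |psiT2 t| ≤ max (-(20 * hi⁻¹ ^ 6 - 56 * lo⁻¹ ^ 9)) (20 * lo⁻¹ ^ 6 - 56 * hi⁻¹ ^ 9) :=
  abs_le_max_neg (psiT2_mem h0 h1 h2).1 (psiT2_mem h0 h1 h2).2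

/-! ## §2 Lipschitz bounds of `ψ`, `ψ′` on a window (mean value theorem with the true derivative sup) -/

/-- ★ `|ψ t − ψ s| ≤ Ψ₁·|t − s|` on `[lo, hi]`, `Ψ₁ = max (−(−4lo⁻⁵ + 7hi⁻⁸)) (−4hi⁻⁵ + 7lo⁻⁸)` (= (238) `abs_psiT1_le`'s bound). [folklore] -/
theorem abs_psiT_sub_le {lo hi s t : ℝ} (h0 : 0 < lo) (hs1 : lo ≤ s) (hs2 : s ≤ hi) (ht1 : lo ≤ t) (ht2 : t ≤ hi) :
    |psiT t - psiT s| ≤ max (-(-4 * lo⁻¹ ^ 5 + 7 * hi⁻¹ ^ 8)) (-4 * hi⁻¹ ^ 5 + 7 * lo⁻¹ ^ 8) * |t - s| := by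
  have hconv : Convex ℝ (Set.Icc lo hi) := convex_Icc lo hi
  have hd : ∀ x ∈ Set.Icc lo hi, HasDerivWithinAt psiT (psiT1 x) (Set.Icc lo hi) x :=
    fun x hx => (hasDerivAt_psiT (h0.trans_le hx.1).ne').hasDerivWithinAt
  have hb : ∀ x ∈ Set.Icc lo hi, ‖psiT1 x‖ ≤ max (-(-4 * lo⁻¹ ^ 5 + 7 * hi⁻¹ ^ 8)) (-4 * hi⁻¹ ^ 5 + 7 * lo⁻¹ ^ 8) :=
    fun x hx => by rw [Real.norm_eq_abs]; exact abs_psiT1_le h0 hx.1 hx.2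
  have h := hconv.norm_image_sub_le_of_norm_hasDerivWithin_le hd hb ⟨hs1, hs2⟩ ⟨ht1, ht2⟩
  simpa only [Real.norm_eq_abs] using h

/-- ★ `|ψ′ t − ψ′ s| ≤ Ψ₂·|t − s|` on `[lo, hi]`, `Ψ₂ = max (−(20hi⁻⁶ − 56lo⁻⁹)) (20lo⁻⁶ − 56hi⁻⁹)`. [folklore] -/
theorem abs_psiT1_sub_le {lo hi s t : ℝ} (h0 : 0 < lo) (hs1 : lo ≤ s) (hs2 : s ≤ hi) (ht1 : lo ≤ t) (ht2 : t ≤ hi) :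
    |psiT1 t - psiT1 s| ≤ max (-(20 * hi⁻¹ ^ 6 - 56 * lo⁻¹ ^ 9)) (20 * lo⁻¹ ^ 6 - 56 * hi⁻¹ ^ 9) * |t - s| := by
  have hconv : Convex ℝ (Set.Icc lo hi) := convex_Icc lo hi
  have hd : ∀ x ∈ Set.Icc lo hi, HasDerivWithinAt psiT1 (psiT2 x) (Set.Icc lo hi) x :=
    fun x hx => (hasDerivAt_psiT1 (h0.trans_le hx.1).ne').hasDerivWithinAt
  have hb : ∀ x ∈ Set.Icc lo hi, ‖psiT2 x‖ ≤ max (-(20 * hi⁻¹ ^ 6 - 56 * lo⁻¹ ^ 9)) (20 * lo⁻¹ ^ 6 - 56 * hi⁻¹ ^ 9) :=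
    fun x hx => by rw [Real.norm_eq_abs]; exact abs_psiT2_le h0 hx.1 hx.2
  have h := hconv.norm_image_sub_le_of_norm_hasDerivWithin_le hd hb ⟨hs1, hs2⟩ ⟨ht1, ht2⟩
  simpa only [Real.norm_eq_abs] using h

/-! ## §3 The linearised pair force is Lipschitz in the metric -/

/-- the Gram form of the identity metric is the dot product. [folklore] -/
theorem gram_one (v w : Fin 3 → ℝ) : gram 1 v w = ∑ i, v i * w i := by
  unfold gram
  refine Finset.sum_congr rfl fun i _ => ?_
  rw [Finset.sum_eq_single i]
  · simp
  · intro j _ hji; simp [Ne.symm hji]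
  · intro h; exact (h (Finset.mem_univ i)).elim

/-- the entries of the identity matrix are `if i = j then 1 else 0`. -/
theorem one_apply_eq (i j : Fin 3) : (1 : Matrix (Fin 3) (Fin 3) ℝ) i j = if i = j then 1 else 0 := Matrix.one_apply

section Lip

variable {G : Matrix (Fin 3) (Fin 3) ℝ} {ε : ℝ}

/-- ★ «NASH-LIP», real half: with `|G − 1| ≤ ε` entrywise, and both `g_G(z,z)` and `Σ z_j²` inside the window `[lo, hi]`,
the linearised pair force in label coordinates moves from its CENTRE value (`G = 1`) by at most
`ε·(Ψ₁·|z|₁²·|y i| + 2·|z i|·(|z|₁·|y|₁·Ψ₁ + |z·y|·Ψ₂·|z|₁²))` in coordinate `i`. [folklore] -/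
theorem abs_linLab_sub_linLab_one_le (hG : ∀ i j, |G i j - (if i = j then 1 else 0)| ≤ ε)
    (z y : Fin 3 → ℝ) (i : Fin 3) {lo hi : ℝ} (h0 : 0 < lo) (h1 : lo ≤ gram G z z) (h2 : gram G z z ≤ hi)
    (h1' : lo ≤ ∑ j, z j * z j) (h2' : ∑ j, z j * z j ≤ hi) :
    |linLab G z y i - linLab 1 z y i|
      ≤ ε * (max (-(-4 * lo⁻¹ ^ 5 + 7 * hi⁻¹ ^ 8)) (-4 * hi⁻¹ ^ 5 + 7 * lo⁻¹ ^ 8) * (∑ j, |z j|) ^ 2 * |y i|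
          + 2 * |z i| * ((∑ j, |z j|) * (∑ j, |y j|) * max (-(-4 * lo⁻¹ ^ 5 + 7 * hi⁻¹ ^ 8)) (-4 * hi⁻¹ ^ 5 + 7 * lo⁻¹ ^ 8)
            + |∑ j, z j * y j| * max (-(20 * hi⁻¹ ^ 6 - 56 * lo⁻¹ ^ 9)) (20 * lo⁻¹ ^ 6 - 56 * hi⁻¹ ^ 9) * (∑ j, |z j|) ^ 2)) := by
  -- names
  set Ψ₁ : ℝ := max (-(-4 * lo⁻¹ ^ 5 + 7 * hi⁻¹ ^ 8)) (-4 * hi⁻¹ ^ 5 + 7 * lo⁻¹ ^ 8) with hΨ₁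
  set Ψ₂ : ℝ := max (-(20 * hi⁻¹ ^ 6 - 56 * lo⁻¹ ^ 9)) (20 * lo⁻¹ ^ 6 - 56 * hi⁻¹ ^ 9) with hΨ₂
  set t : ℝ := gram G z z with ht
  set t₀ : ℝ := ∑ j, z j * z j with ht₀
  set u : ℝ := gram G z y with hu
  set u₀ : ℝ := ∑ j, z j * y j with hu₀
  set Z : ℝ := ∑ j, |z j| with hZ
  set Yn : ℝ := ∑ j, |y j| with hYn
  -- the two enclosures from the near-identity box
  have dt : |t - t₀| ≤ ε * (Z * Z) := by
    have := abs_gram_sub_dot_le hG z z; simpa [ht, ht₀, hZ] using this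
  have du : |u - u₀| ≤ ε * (Z * Yn) := by
    have := abs_gram_sub_dot_le hG z y; simpa [hu, hu₀, hZ, hYn] using this
  -- Lipschitz steps
  have dψ : |psiT t - psiT t₀| ≤ Ψ₁ * |t - t₀| := abs_psiT_sub_le h0 h1' h2' h1 h2
  have dψ' : |psiT1 t - psiT1 t₀| ≤ Ψ₂ * |t - t₀| := abs_psiT1_sub_le h0 h1' h2' h1 h2
  have aψ' : |psiT1 t| ≤ Ψ₁ := abs_psiT1_le h0 h1 h2
  have hΨ₁0 : 0 ≤ Ψ₁ := (abs_nonneg _).trans aψ'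
  have hΨ₂0 : 0 ≤ Ψ₂ := by
    have := abs_psiT2_le h0 h1 h2
    exact (abs_nonneg _).trans this
  have hZ0 : 0 ≤ Z := Finset.sum_nonneg fun j _ => abs_nonneg _
  have hY0 : 0 ≤ Yn := Finset.sum_nonneg fun j _ => abs_nonneg _
  -- the difference, expanded
  have e : linLab G z y i - linLab 1 z y i
      = (psiT t - psiT t₀) * y i + 2 * z i * ((u - u₀) * psiT1 t + u₀ * (psiT1 t - psiT1 t₀)) := by
    simp only [linLab, Pi.add_apply, Pi.smul_apply, smul_eq_mul, gram_one]
    ring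
  rw [e]
  -- bound term by term
  have T1 : |(psiT t - psiT t₀) * y i| ≤ (Ψ₁ * (ε * (Z * Z))) * |y i| := by
    rw [abs_mul]
    exact mul_le_mul_of_nonneg_right (dψ.trans (mul_le_mul_of_nonneg_left dt hΨ₁0)) (abs_nonneg _)
  have T2a : |(u - u₀) * psiT1 t| ≤ (ε * (Z * Yn)) * Ψ₁ := by
    rw [abs_mul]; exact mul_le_mul du aψ' (abs_nonneg _) ((abs_nonneg _).trans du)
  have T2b : |u₀ * (psiT1 t - psiT1 t₀)| ≤ |u₀| * (Ψ₂ * (ε * (Z * Z))) := by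
    rw [abs_mul]
    exact mul_le_mul_of_nonneg_left (dψ'.trans (mul_le_mul_of_nonneg_left dt hΨ₂0)) (abs_nonneg _)
  have T2 : |2 * z i * ((u - u₀) * psiT1 t + u₀ * (psiT1 t - psiT1 t₀))|
      ≤ 2 * |z i| * ((ε * (Z * Yn)) * Ψ₁ + |u₀| * (Ψ₂ * (ε * (Z * Z)))) := by
    rw [abs_mul, abs_mul, abs_two]
    refine mul_le_mul_of_nonneg_left ((abs_add_le _ _).trans (add_le_add T2a T2b)) (by positivity)
  refine (abs_add_le _ _).trans ((add_le_add T1 T2).trans (le_of_eq ?_))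
  ring

end Lip

end Summit.AtomisticToContinuum.Crystallization.Theorems.FrustratedLawDichotomyCellArithLip

end
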